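import Literature.NumberTheory.EllipticCurves.BhargavaShankarLocalWeightProofs
import Literature.NumberTheory.EllipticCurves.BinaryQuarticAdditive
import HarnessLib

/-!
# Bhargava–Shankar's local weights `m_p(f)` are locally constant off `Δ = 0`
# (`m_p` is "defined by congruence conditions")

`Proofs` companion (theorems only: no definitions, no named facts) of
`BinaryQuarticOrbitWeights.lean` and `BhargavaShankarLocalWeightProofs.lean`. Source: M. Bhargava,
A. Shankar, *Binary quartic forms having bounded invariants, and the boundedness of the average rank
of elliptic curves*, Ann. of Math. (2) 181 (2015) 191–242, published version (= `arXiv:1006.1002v3`),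
§3.2: the point of the weights `m(f) = ∏_p m_p(f)` is that "our weight function [is] defined by
congruence conditions" (so that the weighted count `N_m` falls under Thms 2.12 and 2.21, whose
hypothesis is a function `φ = ∏_p φ_p` with `φ_p` locally constant outside a closed set of measure
zero — "acceptable", §2.7). The source does not spell this out; here it is proved:

* `BinaryQuartic.twist_diag_mem_integralForms_iff` — `diag(pⁿ,1) · g ∈ V_{ℤ_p}` iff `pⁿ ∣ d(g)` and
  `p²ⁿ ∣ e(g)` (for `g ∈ V_{ℤ_p}`): the integrality conditions are congruence conditions;
* `BinaryQuartic.norm_disc_eq_of_congr` — `|Δ|_p` is locally constant off `Δ = 0`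
  (`Δ(f') ≡ Δ(f) (mod pᵏ)` when `f' ≡ f (mod pᵏ)`);
* `BinaryQuartic.cosets_eq_of_congr` — **if `Δ(f) ≠ 0`, `p⁻ᵏ < |Δ(f)|_p` and `k ≥ 2⌊1/|Δ(f)|_p⌋`,
  then every `f' ≡ f (mod pᵏ)` has the same coset set `{PGL₂(ℤ_p)g : g · f' ∈ V_{ℤ_p}}` as `f`**
  (via the Cartan decomposition `g⁻¹ = c k₁ diag(pⁿ,1) k₂`: `g · f ∈ V_{ℤ_p}` iff `pⁿ ∣ d`, `p²ⁿ ∣ e`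
  for the form `k₂ · f`, which is `ℤ_p`-linear in `f`, and `n ≤ ⌊1/|Δ(f)|_p⌋` is forced), hence the
  same weight: `BinaryQuartic.localWeight_eq_of_congr`, **`m_p(f') = m_p(f)`**;
* `BinaryQuartic.exists_pow_forall_localWeight_eq`, `BinaryQuartic.eventually_localWeight_eq` — the
  congruence and the topological forms: **`m_p` is locally constant on `{Δ ≠ 0} ⊆ V_{ℤ_p}`**; and
  `BinaryQuartic.exists_pow_forall_localWeightAt_eq` — for `f ∈ V_ℤ` with `Δ(f) ≠ 0` there is `k`
  with `m_p(g) = m_p(f)` for every integral `g ≡ f (mod pᵏ)`.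

## References

* M. Bhargava, A. Shankar, Ann. of Math. (2) 181 (2015) 191–242, §3.2 ("defined by congruence
  conditions") and §2.7 (acceptable functions) of the published version.
  [cite: BhargavaShankarAnnals2015, §3.2 (m_p defined by congruence conditions; published numbering)]
-/

noncomputable section

open scoped Classical Topology
open Matrix MulAction Filter Literature.GroupTheory.Index

namespace Literature.NumberTheory.EllipticCurves

namespace BinaryQuartic

variable {p : ℕ} [Fact p.Prime]

/-! ## Integrality after `diag(pⁿ, 1)` is a congruence condition -/

/-- **`diag(pⁿ,1) · g ∈ V_{ℤ_p}` iff `pⁿ ∣ d(g)` and `p²ⁿ ∣ e(g)`** (`g ∈ V_{ℤ_p}`):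
`diag(pⁿ,1) · g = (p²ⁿa, pⁿb, c, d/pⁿ, e/p²ⁿ)`. [cite: BhargavaShankarAnnals2015, Prop. 3.18, proof, first paragraph (published numbering)] -/
theorem twist_diag_mem_integralForms_iff (n : ℕ) (g : BinaryQuartic ℤ_[p]) :
    twist (!![(p : ℚ_[p]) ^ n, 0; 0, 1]) (g.map PadicInt.Coe.ringHom) ∈
      integralForms (PadicInt.Coe.ringHom (p := p)) ↔
      (p : ℤ_[p]) ^ n ∣ g.d ∧ ((p : ℤ_[p]) ^ n) ^ 2 ∣ g.e := by
  have hpn : ((p : ℤ_[p]) ^ n) ≠ 0 := pow_ne_zero _ (by exact_mod_cast (Fact.out : p.Prime).ne_zero)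
  have hpQ : ((p : ℚ_[p]) ^ n) ≠ 0 := p_pow_ne_zero n
  constructor
  · rintro ⟨h₀, hh₀⟩
    -- as in `pow_dvd_disc_of_diag_smul_integral`
    have hD : (!![(p : ℚ_[p]) ^ n, 0; 0, 1] : Matrix (Fin 2) (Fin 2) ℚ_[p]) =
        (!![(p : ℤ_[p]) ^ n, 0; 0, 1] : Matrix (Fin 2) (Fin 2) ℤ_[p]).map PadicInt.Coe.ringHom := by
      ext i j; fin_cases i <;> fin_cases j <;> simp
    have hsub : g.subst !![(p : ℤ_[p]) ^ n, 0; 0, 1] = (((p : ℤ_[p]) ^ n) ^ 2) • h₀ := by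
      apply map_coe_injective
      have h := hh₀.symm
      rw [twist, det_diagPow, hD, ← map_subst] at h
      have h3 := congrArg (fun F ↦ (((p : ℚ_[p]) ^ n) ^ 2) • F) h
      simp only [smul_smul, mul_inv_cancel₀ (pow_ne_zero 2 hpQ), one_smul] at h3
      rw [h3]
      ext <;> simp [map]
    rw [subst_diagonal] at hsub
    constructor
    · have := congrArg BinaryQuartic.d hsub
      simp only [one_pow, mul_one, smul_d] at this
      refine ⟨h₀.d, mul_right_cancel₀ hpn ?_⟩
      linear_combination this
    · have := congrArg BinaryQuartic.e hsub
      simp only [one_pow, mul_one, smul_e] at this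
      exact ⟨h₀.e, this⟩
  · rintro ⟨⟨d', hd'⟩, ⟨e', he'⟩⟩
    refine ⟨⟨g.a * ((p : ℤ_[p]) ^ n) ^ 2, g.b * (p : ℤ_[p]) ^ n, g.c, d', e'⟩, ?_⟩
    rw [twist, det_diagPow, subst_diagonal]
    ext
    · simp only [map_a, smul_a, map_mul, map_pow, map_natCast]; field_simp
    · simp only [map_b, smul_b, map_mul, map_pow, map_natCast]; field_simp
    · simp only [map_c, smul_c]; field_simp
    · simp only [map_d, smul_d, hd', map_mul, map_pow, map_natCast]; field_simp
    · simp only [map_e, smul_e, he', map_mul, map_pow, map_natCast]; field_simp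

/-! ## Congruent forms -/

/-- `f' ≡ f (mod pᵏ)` coefficientwise means `f' = f + pᵏ w`. [folklore] -/
theorem exists_eq_add_smul_of_congr {k : ℕ} {f f' : BinaryQuartic ℤ_[p]}
    (h : ∀ i, (p : ℤ_[p]) ^ k ∣ f'.coeffs i - f.coeffs i) :
    ∃ w : BinaryQuartic ℤ_[p], f' = f + ((p : ℤ_[p]) ^ k) • w := by
  obtain ⟨wa, ha⟩ := h 0; obtain ⟨wb, hb⟩ := h 1; obtain ⟨wc, hc⟩ := h 2
  obtain ⟨wd, hd⟩ := h 3; obtain ⟨we, he⟩ := h 4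
  simp only [coeffs_zero, coeffs_one, coeffs_two, coeffs_three, coeffs_four] at ha hb hc hd he
  refine ⟨⟨wa, wb, wc, wd, we⟩, ?_⟩
  ext <;> simp only [add_a, add_b, add_c, add_d, add_e, smul_a, smul_b, smul_c, smul_d, smul_e]
  · linear_combination ha
  · linear_combination hb
  · linear_combination hc
  · linear_combination hd
  · linear_combination he

/-- Congruent forms have congruent coefficients after the `ℤ_p`-linear operation `f ↦ u² · f((x,y)k)`.
[folklore] -/
theorem unitTwist_add_smul (u : ℤ_[p]) (k₂ : Matrix (Fin 2) (Fin 2) ℤ_[p]) (f w : BinaryQuartic ℤ_[p]) (t : ℤ_[p]) :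
    (u ^ 2) • (f + t • w).subst k₂ = (u ^ 2) • f.subst k₂ + t • ((u ^ 2) • w.subst k₂) := by
  rw [subst_add, smul_subst]
  ext <;> simp only [smul_a, smul_b, smul_c, smul_d, smul_e, add_a, add_b, add_c, add_d, add_e] <;> ring

/-- Divisibility by `pᵐ`, `m ≤ k`, is unchanged by adding a multiple of `pᵏ`. [folklore] -/
theorem pow_dvd_add_mul_iff {m k : ℕ} (hmk : m ≤ k) (x y : ℤ_[p]) :
    (p : ℤ_[p]) ^ m ∣ x + (p : ℤ_[p]) ^ k * y ↔ (p : ℤ_[p]) ^ m ∣ x := by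
  have h : (p : ℤ_[p]) ^ m ∣ (p : ℤ_[p]) ^ k * y := dvd_mul_of_dvd_left (pow_dvd_pow _ hmk) _
  exact dvd_add_left h

/-- **`|Δ|_p` is locally constant off `Δ = 0`**: if `f' ≡ f (mod pᵏ)` then `Δ(f') ≡ Δ(f) (mod pᵏ)`,
so `|Δ(f')|_p = |Δ(f)|_p` as soon as `p⁻ᵏ < |Δ(f)|_p`. [folklore] -/
theorem norm_disc_eq_of_congr {k : ℕ} {f f' : BinaryQuartic ℤ_[p]}
    (h : ∀ i, (p : ℤ_[p]) ^ k ∣ f'.coeffs i - f.coeffs i) (hk : (p : ℝ) ^ (-(k : ℤ)) < ‖f.disc‖) :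
    ‖f'.disc‖ = ‖f.disc‖ := by
  -- `Δ(f') - Δ(f) ∈ pᵏℤ_p`, by reduction modulo `pᵏ`
  have hred : f'.map (PadicInt.toZModPow k) = f.map (PadicInt.toZModPow k) := by
    have hc : ∀ i, PadicInt.toZModPow k (f'.coeffs i) = PadicInt.toZModPow k (f.coeffs i) := fun i ↦ by
      rw [← sub_eq_zero, ← map_sub, ← RingHom.mem_ker, PadicInt.ker_toZModPow, Ideal.mem_span_singleton]
      exact h i
    have h0 := hc 0; have h1 := hc 1; have h2 := hc 2; have h3 := hc 3; have h4 := hc 4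
    simp only [coeffs_zero, coeffs_one, coeffs_two, coeffs_three, coeffs_four] at h0 h1 h2 h3 h4
    ext <;> simp [map, h0, h1, h2, h3, h4]
  have hdvd : (p : ℤ_[p]) ^ k ∣ f'.disc - f.disc := by
    rw [← Ideal.mem_span_singleton, ← PadicInt.ker_toZModPow, RingHom.mem_ker, map_sub, ← disc_map,
      ← disc_map, hred, sub_self]
  have hle : ‖f'.disc - f.disc‖ ≤ (p : ℝ) ^ (-(k : ℤ)) :=
    (PadicInt.norm_le_pow_iff_mem_span_pow _ k).mpr (Ideal.mem_span_singleton.mpr hdvd)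
  have hlt : ‖f'.disc - f.disc‖ < ‖f.disc‖ := hle.trans_lt hk
  have : f'.disc = (f'.disc - f.disc) + f.disc := by ring
  rw [this, PadicInt.norm_add_eq_max_of_ne hlt.ne, max_eq_right hlt.le]

/-- The twisted action of (the image of) a unit matrix does not change `|Δ|_p`. [folklore] -/
theorem norm_disc_unitTwist {k₂ k₂' : Matrix (Fin 2) (Fin 2) ℤ_[p]} (hk₂ : k₂ * k₂' = 1) (f : BinaryQuartic ℤ_[p]) :
    ‖((k₂'.det ^ 2) • f.subst k₂).disc‖ = ‖f.disc‖ := by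
  have hdet2 : k₂.det * k₂'.det = 1 := by rw [← Matrix.det_mul, hk₂, Matrix.det_one]
  have hg : twist (k₂.map PadicInt.Coe.ringHom) (f.map PadicInt.Coe.ringHom) =
      ((k₂'.det ^ 2) • f.subst k₂).map PadicInt.Coe.ringHom := twist_map_map_eq _ hdet2 f
  have h3 : (3 : ℚ_[p]) ≠ 0 := by norm_num
  let u₂ : GL (Fin 2) ℤ_[p] := ⟨k₂, k₂', hk₂, mul_eq_one_comm.mp hk₂⟩
  have hK : (k₂.map PadicInt.Coe.ringHom).det ≠ 0 := by
    rw [show k₂ = (u₂ : Matrix (Fin 2) (Fin 2) ℤ_[p]) from rfl, ← coe_mapGL u₂]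
    exact det_coe_ne_zero _
  have := disc_twist h3 hK (f.map PadicInt.Coe.ringHom)
  rw [hg, disc_map, disc_map] at this
  rw [← PadicInt.padic_norm_e_of_padicInt, ← PadicInt.padic_norm_e_of_padicInt]
  exact congrArg _ this

/-! ## The coset set is locally constant -/

/-- The integrality of `h⁻¹ · f` only involves `diag(pⁿ,1) · (k₂ · f)` for a Cartan decomposition
`h⁻¹ = c k₁ diag(pⁿ,1) k₂`. [folklore] -/
theorem inv_smul_mem_integralForms_iff {h : GL (Fin 2) ℚ_[p]} {c : ℚ_[p]} {n : ℕ}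
    {k₁ k₁' k₂ k₂' : Matrix (Fin 2) (Fin 2) ℤ_[p]} (hc : c ≠ 0) (hk₁ : k₁' * k₁ = 1) (hk₂ : k₂ * k₂' = 1)
    (hγ : ((h⁻¹ : GL (Fin 2) ℚ_[p]) : Matrix (Fin 2) (Fin 2) ℚ_[p]) =
      c • (k₁.map PadicInt.Coe.ringHom * !![(p : ℚ_[p]) ^ n, 0; 0, 1] * k₂.map PadicInt.Coe.ringHom))
    (f : BinaryQuartic ℤ_[p]) :
    h⁻¹ • f.map PadicInt.Coe.ringHom ∈ integralForms (PadicInt.Coe.ringHom (p := p)) ↔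
      (p : ℤ_[p]) ^ n ∣ ((k₂'.det ^ 2) • f.subst k₂).d ∧ ((p : ℤ_[p]) ^ n) ^ 2 ∣ ((k₂'.det ^ 2) • f.subst k₂).e := by
  -- the units, as in `exists_rep_of_mem_cosets`
  let u₁ : GL (Fin 2) ℤ_[p] := ⟨k₁, k₁', mul_eq_one_comm.mp hk₁, hk₁⟩
  let u₂ : GL (Fin 2) ℤ_[p] := ⟨k₂, k₂', hk₂, mul_eq_one_comm.mp hk₂⟩
  set d : GL (Fin 2) ℚ_[p] := Matrix.GeneralLinearGroup.mkOfDetNeZero (!![(p : ℚ_[p]) ^ n, 0; 0, 1])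
    (by rw [det_diagPow]; exact p_pow_ne_zero n) with hd
  let z : GL (Fin 2) ℚ_[p] := Matrix.GeneralLinearGroup.scalar (Fin 2) (Units.mk0 c hc)
  have hz : z ∈ integralUpToScalars (PadicInt.Coe.ringHom (p := p)) := scalar_mem hc
  have hinv : h⁻¹ = z * Matrix.GeneralLinearGroup.map PadicInt.Coe.ringHom u₁ * d *
      Matrix.GeneralLinearGroup.map PadicInt.Coe.ringHom u₂ := by
    apply Units.ext
    rw [hγ]
    simp only [Units.val_mul, coe_mapGL, hd, coe_diagGL, z, Matrix.GeneralLinearGroup.coe_scalar,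
      Units.val_mk0, Matrix.scalar_apply]
    rw [Matrix.smul_eq_diagonal_mul]
    simp only [Matrix.mul_assoc, u₁, u₂]
  have hdet2 : k₂.det * k₂'.det = 1 := by rw [← Matrix.det_mul, hk₂, Matrix.det_one]
  have hg : Matrix.GeneralLinearGroup.map PadicInt.Coe.ringHom u₂ • f.map PadicInt.Coe.ringHom =
      ((k₂'.det ^ 2) • f.subst k₂).map PadicInt.Coe.ringHom := by
    rw [gl_smul_def, coe_mapGL]
    exact twist_map_map_eq _ hdet2 f
  have hzu : z * Matrix.GeneralLinearGroup.map PadicInt.Coe.ringHom u₁ ∈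
      integralUpToScalars (PadicInt.Coe.ringHom (p := p)) :=
    (integralUpToScalars _).mul_mem hz (mapGL_mem u₁)
  rw [← twist_diag_mem_integralForms_iff, ← hg, ← coe_diagGL n, ← hd, ← gl_smul_def, ← mul_smul]
  have hfac : h⁻¹ = (z * Matrix.GeneralLinearGroup.map PadicInt.Coe.ringHom u₁) *
      (d * Matrix.GeneralLinearGroup.map PadicInt.Coe.ringHom u₂) := by rw [hinv]; group
  constructor
  · intro hint
    have : (d * Matrix.GeneralLinearGroup.map PadicInt.Coe.ringHom u₂) • f.map PadicInt.Coe.ringHom =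
        (z * Matrix.GeneralLinearGroup.map PadicInt.Coe.ringHom u₁)⁻¹ • (h⁻¹ • f.map PadicInt.Coe.ringHom) := by
      rw [hfac]; simp only [← mul_smul]; congr 1; group
    rw [this]
    exact smul_mem_integralForms _ ((integralUpToScalars _).inv_mem hzu) hint
  · intro hint
    rw [hfac, mul_smul]
    exact smul_mem_integralForms _ hzu hint

/-- **The coset set is locally constant off `Δ = 0`.** If `Δ(f) ≠ 0`, `p⁻ᵏ < |Δ(f)|_p`,
`k ≥ 2⌊1/|Δ(f)|_p⌋` and `f' ≡ f (mod pᵏ)`, then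
`{PGL₂(ℤ_p)g : g · f' ∈ V_{ℤ_p}} = {PGL₂(ℤ_p)g : g · f ∈ V_{ℤ_p}}`.
[cite: BhargavaShankarAnnals2015, §3.2 (m_p defined by congruence conditions; published numbering)] -/
theorem cosets_eq_of_congr {k : ℕ} (f f' : BinaryQuartic ℤ_[p]) (hΔ : f.disc ≠ 0)
    (hk : (p : ℝ) ^ (-(k : ℤ)) < ‖f.disc‖) (hk2 : 2 * ⌊‖f.disc‖⁻¹⌋₊ ≤ k)
    (h : ∀ i, (p : ℤ_[p]) ^ k ∣ f'.coeffs i - f.coeffs i) :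
    cosets (PadicInt.Coe.ringHom (p := p)) (f'.map PadicInt.Coe.ringHom) =
      cosets (PadicInt.Coe.ringHom (p := p)) (f.map PadicInt.Coe.ringHom) := by
  obtain ⟨w, rfl⟩ := exists_eq_add_smul_of_congr h
  have hnorm' : ‖(f + ((p : ℤ_[p]) ^ k) • w).disc‖ = ‖f.disc‖ := norm_disc_eq_of_congr h hk
  ext q
  induction q using QuotientGroup.induction_on with
  | H hh =>
  rw [coe_mem_cosets_iff, coe_mem_cosets_iff]
  obtain ⟨c, n, k₁, k₁', k₂, k₂', hc, hk₁, hk₂, hγ⟩ := exists_cartan_decomposition (det_coe_ne_zero hh⁻¹)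
  rw [inv_smul_mem_integralForms_iff hc hk₁ hk₂ hγ, inv_smul_mem_integralForms_iff hc hk₁ hk₂ hγ,
    unitTwist_add_smul]
  set g : BinaryQuartic ℤ_[p] := (k₂'.det ^ 2) • f.subst k₂ with hgdef
  set v : BinaryQuartic ℤ_[p] := (k₂'.det ^ 2) • w.subst k₂ with hvdef
  have hng : ‖g.disc‖ = ‖f.disc‖ := norm_disc_unitTwist hk₂ f
  have hng' : ‖(g + ((p : ℤ_[p]) ^ k) • v).disc‖ = ‖f.disc‖ := by
    rw [hgdef, hvdef, ← unitTwist_add_smul, norm_disc_unitTwist hk₂, hnorm']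
  -- the exponent is bounded on both sides
  have hbound : ∀ {G : BinaryQuartic ℤ_[p]}, ‖G.disc‖ = ‖f.disc‖ →
      ((p : ℤ_[p]) ^ n ∣ G.d ∧ ((p : ℤ_[p]) ^ n) ^ 2 ∣ G.e) → 2 * n ≤ k := fun {G} hG hdiv ↦ by
    obtain ⟨h₀, hh₀⟩ := (twist_diag_mem_integralForms_iff n G).mpr hdiv
    have hle := norm_disc_le_of_diag_smul_integral G h₀ hh₀.symm
    rw [hG] at hle
    have := le_floor_of_norm_le hΔ hle
    omega
  -- `(pⁿ)² = p²ⁿ`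
  have hsq : ((p : ℤ_[p]) ^ n) ^ 2 = (p : ℤ_[p]) ^ (2 * n) := by rw [← pow_mul, mul_comm]
  constructor
  · intro hdiv
    have h2n := hbound hng' hdiv
    simp only [add_d, add_e, smul_d, smul_e, hsq] at hdiv
    rw [hsq]
    exact ⟨(pow_dvd_add_mul_iff (m := n) (k := k) (by omega) g.d v.d).mp hdiv.1,
      (pow_dvd_add_mul_iff (m := 2 * n) (k := k) h2n g.e v.e).mp hdiv.2⟩
  · intro hdiv
    have h2n := hbound hng hdiv
    simp only [add_d, add_e, smul_d, smul_e, hsq]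
    rw [hsq] at hdiv
    exact ⟨(pow_dvd_add_mul_iff (m := n) (k := k) (by omega) g.d v.d).mpr hdiv.1,
      (pow_dvd_add_mul_iff (m := 2 * n) (k := k) h2n g.e v.e).mpr hdiv.2⟩

/-- **`m_p(f') = m_p(f)` for `f' ≡ f (mod pᵏ)`** (`Δ(f) ≠ 0`, `k` as above). [cite: BhargavaShankarAnnals2015, §3.2 (m_p defined by congruence conditions; published numbering)] -/
theorem localWeight_eq_of_congr {k : ℕ} (f f' : BinaryQuartic ℤ_[p]) (hΔ : f.disc ≠ 0)
    (hk : (p : ℝ) ^ (-(k : ℤ)) < ‖f.disc‖) (hk2 : 2 * ⌊‖f.disc‖⁻¹⌋₊ ≤ k)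
    (h : ∀ i, (p : ℤ_[p]) ^ k ∣ f'.coeffs i - f.coeffs i) : localWeight f' = localWeight f := by
  have hΔ' : f'.disc ≠ 0 := by
    rw [← norm_pos_iff, norm_disc_eq_of_congr h hk, norm_pos_iff]; exact hΔ
  rw [localWeight_eq_ncard_cosets f' hΔ', localWeight_eq_ncard_cosets f hΔ, cosets_eq_of_congr f f' hΔ hk hk2 h]

/-- **Congruence form**: for `Δ(f) ≠ 0` there is `k` such that every `f' ≡ f (mod pᵏ)` has the same
coset set and the same weight `m_p(f') = m_p(f)`. [cite: BhargavaShankarAnnals2015, §3.2 (m_p defined by congruence conditions; published numbering)] -/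
theorem exists_pow_forall_localWeight_eq (f : BinaryQuartic ℤ_[p]) (hΔ : f.disc ≠ 0) :
    ∃ k : ℕ, ∀ f' : BinaryQuartic ℤ_[p], (∀ i, (p : ℤ_[p]) ^ k ∣ f'.coeffs i - f.coeffs i) →
      cosets (PadicInt.Coe.ringHom (p := p)) (f'.map PadicInt.Coe.ringHom) =
        cosets (PadicInt.Coe.ringHom (p := p)) (f.map PadicInt.Coe.ringHom) ∧
      localWeight f' = localWeight f := by
  obtain ⟨k₀, hk₀⟩ := PadicInt.exists_pow_neg_lt p (norm_pos_iff.mpr hΔ)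
  set k := max k₀ (2 * ⌊‖f.disc‖⁻¹⌋₊) with hkdef
  have hk : (p : ℝ) ^ (-(k : ℤ)) < ‖f.disc‖ := by
    refine lt_of_le_of_lt ?_ hk₀
    have hp : (1 : ℝ) < p := by exact_mod_cast (Fact.out : p.Prime).one_lt
    exact zpow_le_zpow_right₀ hp.le (by simp [hkdef])
  refine ⟨k, fun f' hf' ↦ ⟨cosets_eq_of_congr f f' hΔ hk (le_max_right _ _) hf',
    localWeight_eq_of_congr f f' hΔ hk (le_max_right _ _) hf'⟩⟩

/-- The residue class `{f' ≡ f (mod pᵏ)}` is a neighbourhood of `f` in `V_{ℤ_p}`. [folklore] -/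
theorem setOf_congr_mem_nhds (f : BinaryQuartic ℤ_[p]) (k : ℕ) :
    {f' : BinaryQuartic ℤ_[p] | ∀ i, (p : ℤ_[p]) ^ k ∣ f'.coeffs i - f.coeffs i} ∈ 𝓝 f := by
  have hpos : (0 : ℝ) < (p : ℝ) ^ (-(k : ℤ)) := zpow_pos (by exact_mod_cast (Fact.out : p.Prime).pos) _
  have hball : Metric.ball f.coeffs ((p : ℝ) ^ (-(k : ℤ))) ∈ 𝓝 f.coeffs := Metric.ball_mem_nhds _ hpos
  refine Filter.mem_of_superset (continuous_coeffs.continuousAt.preimage_mem_nhds hball) fun f' hf' i ↦ ?_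
  rw [Set.mem_preimage, Metric.mem_ball] at hf'
  have hi : ‖f'.coeffs i - f.coeffs i‖ ≤ (p : ℝ) ^ (-(k : ℤ)) := by
    refine le_of_lt (lt_of_le_of_lt ?_ hf')
    rw [dist_eq_norm]
    exact norm_le_pi_norm (f'.coeffs - f.coeffs) i
  exact Ideal.mem_span_singleton.mp ((PadicInt.norm_le_pow_iff_mem_span_pow _ k).mp hi)

/-- **`m_p` is locally constant off `Δ = 0`**: for `Δ(f) ≠ 0`, all `f'` near `f` have
`m_p(f') = m_p(f)` (and the same coset set). [cite: BhargavaShankarAnnals2015, §3.2 and §2.7 (acceptable functions; published numbering)] -/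
theorem eventually_localWeight_eq (f : BinaryQuartic ℤ_[p]) (hΔ : f.disc ≠ 0) :
    ∀ᶠ f' in 𝓝 f, localWeight f' = localWeight f := by
  obtain ⟨k, hk⟩ := exists_pow_forall_localWeight_eq f hΔ
  filter_upwards [setOf_congr_mem_nhds f k] with f' hf'
  exact (hk f' hf').2

/-- The level sets `{Δ ≠ 0, m_p = m}` are open in `V_{ℤ_p}`. [folklore] -/
theorem isOpen_setOf_disc_ne_zero_and_localWeight_eq (m : ℕ) :
    IsOpen {f : BinaryQuartic ℤ_[p] | f.disc ≠ 0 ∧ localWeight f = m} := by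
  rw [isOpen_iff_mem_nhds]
  rintro f ⟨hΔ, rfl⟩
  have hopen : {f' : BinaryQuartic ℤ_[p] | f'.disc ≠ 0} ∈ 𝓝 f :=
    (isOpen_ne_fun continuous_disc continuous_const).mem_nhds hΔ
  filter_upwards [hopen, eventually_localWeight_eq f hΔ] with f' h1 h2
  exact ⟨h1, h2⟩

/-- **For `f ∈ V_ℤ` with `Δ(f) ≠ 0`: `m_p(g) = m_p(f)` for every integral `g ≡ f (mod pᵏ)`**, `k`
large. [cite: BhargavaShankarAnnals2015, §3.2 (m_p defined by congruence conditions; published numbering)] -/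
theorem exists_pow_forall_localWeightAt_eq (f : BinaryQuartic ℤ) (hΔ : f.disc ≠ 0) :
    ∃ k : ℕ, ∀ g : BinaryQuartic ℤ, (∀ i, (p : ℤ) ^ k ∣ g.coeffs i - f.coeffs i) →
      localWeightAt p g = localWeightAt p f := by
  have hΔ' : (f.map (Int.castRingHom ℤ_[p])).disc ≠ 0 := by
    rw [disc_map]
    exact Int.cast_ne_zero.mpr hΔ
  obtain ⟨k, hk⟩ := exists_pow_forall_localWeight_eq (f.map (Int.castRingHom ℤ_[p])) hΔ'
  refine ⟨k, fun g hg ↦ ?_⟩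
  rw [localWeightAt_of_prime, localWeightAt_of_prime]
  refine (hk _ fun i ↦ ?_).2
  rw [coeffs_map, coeffs_map]
  have := map_dvd (Int.castRingHom ℤ_[p]) (hg i)
  simpa using this

end BinaryQuartic

end Literature.NumberTheory.EllipticCurves

end
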